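import Summits.CriticalPhenomena.CardyFormulaZ2.Theorems.CardyComplexConeParafermionToSLESixFamiliesIicDefs
import Literature.Analysis.Complex.StripPositivityRigidityWeak
import HarnessLib

/-!
# Stub S4 `stub_stripRigidity` of line `iic-trace-flux-pairing` (crux `ParafermionToSLESixFamilies`, stmt-CriticalPhenomena-11389)

Route `CardyComplexCone` (sub-problem `CriticalPhenomena/CardyFormulaZ2`), crux
`Summit.CriticalPhenomena.CardyFormulaZ2.Theses.CardyComplexCone.ParafermionToSLESixFamilies`, line `iic-trace-flux-pairing`
(skeleton `Cruxes/ParafermionToSLESixFamilies/Lines/iic_trace_flux_pairing.lean`, vocabulary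
`Theorems/CardyComplexConeParafermionToSLESixFamiliesIicDefs.lean`). The registered stub S4 reads `stub_stripRigidity : StripRigidityWeak`:
a holomorphic function on the open strip `{0 < im w < 1}` with growth `C (im w)^{-p} (1 − im w)^{-p} e^{a|re w|}`, `p < 1`, `a < 2π`,
whose weak boundary values on both lines (tested against smooth compactly supported `φ ≥ 0` supported off finite exceptional sets) are
non-negative reals, is a non-negative constant. This is, verbatim, the Literature theorem
`Literature.Analysis.Complex.strip_rigidity_of_nonneg_weak_boundary_values` (`Literature/Analysis/Complex/StripPositivityRigidityWeak.lean`: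
mollification in `re w`, invisibility of the finite exceptional sets, double Schwarz reflection, Laurent modes `e^{-πw}, 1, e^{πw}` for
type `< 2π`, positivity on both lines), so the stub closes by that term. In the line, `u = (f/(Φ′)^{1/3}) ∘ Φ⁻¹` for a subsequential
limit `f` of `δ^{-1/3}F_δ` on a rectilinear polygon transported by the strip map `Φ`; the conclusion identifies `f = c (Φ′)^{1/3}`, `c ≥ 0`
(step (v) of the engine S5).
-/

noncomputable section

namespace Summit.CriticalPhenomena.CardyFormulaZ2.Cruxes.ParafermionToSLESixFamilies.IicTraceFluxPairing

/-- **Stub S4 `stub_stripRigidity`** (registered signature `StripRigidityWeak`): strip rigidity from non-negative weak boundary values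
on both lines, for holomorphic functions of growth `(im w)^{-p}(1 − im w)^{-p}e^{a|re w|}`, `p < 1`, `a < 2π` — the Literature theorem
`strip_rigidity_of_nonneg_weak_boundary_values`, whose statement is `StripRigidityWeak` unfolded. -/
theorem stub_stripRigidity : StripRigidityWeak :=
  Literature.Analysis.Complex.strip_rigidity_of_nonneg_weak_boundary_values

end Summit.CriticalPhenomena.CardyFormulaZ2.Cruxes.ParafermionToSLESixFamilies.IicTraceFluxPairing

end
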